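import Literature.NumberTheory.Weil1964.AdelicMetaplecticArchSection
import Literature.NumberTheory.Weil1964.AdelicMetaplecticArchCovariance
import Literature.NumberTheory.Weil1964.ArchMetaplecticSiegelValue
import Literature.NumberTheory.Weil1964.ArchCovariantSchur
import Literature.NumberTheory.Weil1964.ArchSiegelDecomposition
import Literature.NumberTheory.Weil1964.ArchSiegelLeviDual
import Literature.NumberTheory.Weil1964.ArchPhaseMapSymplectic
import Literature.NumberTheory.Weil1964.AdelicMetaplecticTensorStripping
import Literature.NumberTheory.Weil1964.AdelicMetaplecticFiniteImplementer
import HarnessLib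

/-!
# The value at the origin of the conjugated archimedean lift on a Siegel element

Topic `NumberTheory/Weil1964`; namespace `Literature.NumberTheory.Weil1964`.  KERNEL MATHEMATICS ONLY: proved
theorems; no definition, no `def … : Prop` record, no axiom, no proof hole.

The setting of `AdelicMetaplecticArchSection`: a section `s : G →* Mp^𝓢(ℝ^σ)` read in a Folland frame `e` over
`j : G →* Sp(W_𝔸)` (dictionary `hdict`, finite vectors fixed `hj`), and its archimedean lift
`archLift : G →* Mp_ψ(W_𝔸)ᶜᵒⁿᵗ`, `ω(archLift g) = (e^* s(g) e_*) ⊗ 1`.  Let moreover `r ∈ Mp_ψ(W_𝔸)ᶜᵒⁿᵗ` have an operator of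
tensor form `ω(r)(Φ_∞ ⊗ f) = A Φ_∞ ⊗ P f` (e.g. Weil's `r_F(δ)` of a rational `δ`, by tensor stripping) and let
`z ∈ Mp^𝓢(ℝ^σ)` lie over the archimedean phase map of `π(r)` (it exists: `exists_MpS_over_archPhaseMap`).  Then:

* §1 `carrierConjEquiv_archModTrans_of_proj` — `e^* z e_*` is Weil-covariant over `π(r)`; hence (archimedean Schur,
  `exists_smul_of_archCovariant`, and the converse dictionary `archCovariant_of_map_tmul'`) **`A = c · e^* z e_*`**
  (`exists_eq_smul_carrierConjEquiv`);
* §2 **`omega_conj_archLift_tmul`**: `ω(r · archLift g · r⁻¹)(Φ_∞ ⊗ f) = (e^* (z s(g) z⁻¹) e_* Φ_∞) ⊗ f` — conjugating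
  the lift by `r` is conjugating the section by `z` INSIDE `Mp^𝓢(ℝ^σ)` (the scalar `c` cancels);
* §3 **`omega_conj_archLift_apply_zero`**: if `(w f)(0) = κ f(0)` on `𝓢(ℝ^σ)` for `w = z s(g) z⁻¹`, then
  `(ω(r · archLift g · r⁻¹) Ψ)(0) = κ Ψ(0)` for EVERY `Ψ ∈ 𝒮(𝔸^ι)` (pure tensors and linearity);
* §4 **`exists_originValue_of_siegel`** — THE VALUE AT THE ORIGIN ON A SIEGEL ELEMENT: if `π(w)` preserves the
  Lagrangian `0 × ℝ^σ` both ways (`π(r) j(g) π(r)⁻¹ ∈ P_Y` read at `∞`), then `π(w) = m(a, d) n(b)`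
  (`ArchSiegelDecomposition`), `w = u · (levi a d · unip b)` with `|u| = 1`, and
  `(ω(r · archLift g · r⁻¹) Ψ)(0) = u · |det a|^{-1/2} · Ψ(0)` for all `Ψ`; and **`sq_originValue_eq_quot`**: if
  `det a > 0` then `u² = quot (s g)` (`ArchMetaplecticSiegelValue`, `quot_conj`).

This is the archimedean computation behind the Siegel-parabolic normalisation of the Weil representation of a
unitary group restricted from `Mp(W_𝐀)` [GelbartRogawski1991, §3.1; Kudla1994, §3 (3.5); HarrisKudlaSweet1996, §1:
`ω(m(a))φ(0) = χ(det a)|det a|^{1/2} φ(0)`], with the modulus `|det a|^{-1/2}` read in Folland's Schwartz model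
[Folland1989, (4.24)] and the unitary part pinned, up to a sign, by the quotient character.

## References

* [GelbartRogawski1991] S. Gelbart, J. Rogawski, Invent. math. 105 (1991), §3.1 p. 454.
* [Kudla1994] S. Kudla, Israel J. Math. 87 (1994), §3.
* [HarrisKudlaSweet1996] M. Harris, S. Kudla, W. Sweet, J. AMS 9 (1996), §1.
* [Folland1989] G. B. Folland, *Harmonic Analysis in Phase Space*, Princeton UP 1989, §4.2 (4.23)–(4.25), Thm. (4.37).
* [Weil1964] A. Weil, Acta Math. 111 (1964), Chap. I n° 13, Chap. III n° 37–38 pp. 188–190.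
-/

set_option autoImplicit false

noncomputable section

open MeasureTheory Complex SchwartzMap
open scoped TensorProduct Classical Matrix
open NumberField NumberField.mixedEmbedding IsDedekindDomain

namespace Literature.NumberTheory.Weil1964

open Literature.Analysis.SegalBargmann Literature.RepresentationTheory.HeisenbergGroup
open Literature.NumberTheory.Automorphic MpS

variable {F : Type} [Field F] [NumberField F] {ι : Type} [Fintype ι] [DecidableEq ι]
  (T : Matrix ι ι (AdeleRing (𝓞 F) F)) {σ : Type*} [Fintype σ] [DecidableEq σ]
  (e : (ι → mixedSpace F) ≃L[ℝ] (σ → ℝ)) (hT' : IsUnit (archMat F ι T))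


/-! ## §0 Every `r ∈ Mp_ψ(W_𝔸)ᶜᵒⁿᵗ` has an operator of tensor form -/

section TensorForm

set_option maxHeartbeats 1600000 in
-- (matching the finite-implementer identity across files is instance-heavy)
/-- **tensor form of `ω(r)`** for every `r ∈ Mp_ψ(W_𝔸)ᶜᵒⁿᵗ` (`y ↦ T y` onto): `ω(r)(Φ_∞ ⊗ f) = A Φ_∞ ⊗ P f` with `A` a
topological automorphism of `𝓢(X_∞)` — Weil's finite implementer (`exists_finImplementer`) and tensor stripping
(`exists_continuousLinearEquiv_map_tmul_of_mem_adelicMpCont`). [cite: Weil1964, Chap. III n° 37–38 pp. 188–190;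
MoeglinVignerasWaldspurger1987, Chap. 2 II.1 (A)] -/
theorem exists_omega_tmul (hT : Function.Surjective fun y : ι → AdeleRing (𝓞 F) F => T *ᵥ y) (r : adelicMpCont F ι T) :
    ∃ (A : 𝓢((ι → mixedSpace F), ℂ) ≃L[ℂ] 𝓢((ι → mixedSpace F), ℂ)) (Mf : FinSB F ι ≃ₗ[ℂ] FinSB F ι),
      ∀ (Φ : 𝓢((ι → mixedSpace F), ℂ)) (f : FinSB F ι),
        adelicMpCont.omega F ι T r (piSchwartzBruhatEquiv F ι (Φ ⊗ₜ f)) = piSchwartzBruhatEquiv F ι (A Φ ⊗ₜ Mf f) := by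
  obtain ⟨Mf, hMf⟩ := exists_finImplementer (T := T) hT (r : adelicMp F ι T)
  obtain ⟨A, hA⟩ := exists_continuousLinearEquiv_map_tmul_of_mem_adelicMpCont hT (r : adelicMp F ι T) r.2 Mf hMf
  exact ⟨A, Mf, fun Φ f => (hA Φ f).1⟩

end TensorForm

/-! ## §1 `e^* z e_*` is Weil-covariant over `π(r)`; the archimedean factor of `r` is `c · e^* z e_*` -/

section Covariant

omit [DecidableEq σ] in
/-- **an element `z ∈ Mp^𝓢(ℝ^σ)` over the archimedean phase map of `ĝ` gives a Weil-covariant `e^* z e_*` over `ĝ`.**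
[cite: Weil1964, Chap. III n° 38 p. 189; Folland1989, §4.2 (4.23)] -/
theorem carrierConjEquiv_archModTrans_of_proj (ĝ : symplecticGroup (polar (adelicForm F ι T))) (z : MpS σ)
    (hz : (⇑((MpS.proj z).1 : ((σ → ℝ) × (σ → ℝ)) ≃ₗ[ℝ] ((σ → ℝ) × (σ → ℝ))) :
      ((σ → ℝ) × (σ → ℝ)) → ((σ → ℝ) × (σ → ℝ))) = archPhaseMap T e hT' ĝ)
    (a w : ι → mixedSpace F) (Φ : 𝓢((ι → mixedSpace F), ℂ)) :
    carrierConjEquiv e z.1.2 (archModTrans F ι T a w Φ) =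
      weilPhase T ĝ (a, w) •
        archModTrans F ι T (archAct T ĝ (a, w)).1 (archAct T ĝ (a, w)).2 (carrierConjEquiv e z.1.2 Φ) := by
  have hcov : ∀ (p q : σ → ℝ) (f : (SchwartzMap (σ → ℝ) ℂ)), z.1.2 (rhoS p q f) =
      rhoS ((((MpS.proj z).1 : ((σ → ℝ) × (σ → ℝ)) ≃ₗ[ℝ] ((σ → ℝ) × (σ → ℝ))) : PhaseMap σ) (p, q)).1
        ((((MpS.proj z).1 : ((σ → ℝ) × (σ → ℝ)) ≃ₗ[ℝ] ((σ → ℝ) × (σ → ℝ))) : PhaseMap σ) (p, q)).2 (z.1.2 f) :=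
    ((MpS.mem_iff_covariant _).1 z.2).1
  have hA : ∀ (p q : σ → ℝ) (Ψ : 𝓢((ι → mixedSpace F), ℂ)),
      (carrierConjEquiv e z.1.2 : 𝓢((ι → mixedSpace F), ℂ) →L[ℂ] 𝓢((ι → mixedSpace F), ℂ)) (rhoSD e p q Ψ) =
        rhoSD e (archPhaseMap T e hT' ĝ (p, q)).1 (archPhaseMap T e hT' ĝ (p, q)).2
          ((carrierConjEquiv e z.1.2 : 𝓢((ι → mixedSpace F), ℂ) →L[ℂ] 𝓢((ι → mixedSpace F), ℂ)) Ψ) := by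
    intro p q Ψ
    rw [coe_carrierConjEquiv, ← hz]
    exact carrierConj_rhoSD e hcov p q Ψ
  exact arch_implements_of_covariant_rhoSD_clm T e hT' ĝ _ hA a w Φ

variable (r : adelicMpCont F ι T)
  (A : 𝓢((ι → mixedSpace F), ℂ) ≃L[ℂ] 𝓢((ι → mixedSpace F), ℂ)) (P : FinSB F ι ≃ₗ[ℂ] FinSB F ι)
  (hr : ∀ (Φ : 𝓢((ι → mixedSpace F), ℂ)) (f : FinSB F ι),
    adelicMpCont.omega F ι T r (piSchwartzBruhatEquiv F ι (Φ ⊗ₜ f)) = piSchwartzBruhatEquiv F ι (A Φ ⊗ₜ P f))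
  (z : MpS σ)
  (hz : (⇑((MpS.proj z).1 : ((σ → ℝ) × (σ → ℝ)) ≃ₗ[ℝ] ((σ → ℝ) × (σ → ℝ))) :
      ((σ → ℝ) × (σ → ℝ)) → ((σ → ℝ) × (σ → ℝ))) = archPhaseMap T e hT' (adelicMpCont.proj F ι T r))

include hr in
/-- the tensor form of `ω(r)` read on the underlying pair. [cite: Weil1964, Chap. III n° 38 p. 189] -/
theorem coe_snd_apply_tmul (Φ : 𝓢((ι → mixedSpace F), ℂ)) (f : FinSB F ι) :
    ((r : adelicMp F ι T) : symplecticGroup (polar (adelicForm F ι T)) ×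
        (piSchwartzBruhat F ι ≃ₗ[ℂ] piSchwartzBruhat F ι)).2 (piSchwartzBruhatEquiv F ι (Φ ⊗ₜ f)) =
      piSchwartzBruhatEquiv F ι (A Φ ⊗ₜ P f) := by
  rw [← hr Φ f, adelicMpCont.omega_apply, omegaPsi_apply]

include hr hz in
/-- **the archimedean factor of `r` is `c · e^* z e_*`, `c ≠ 0`** (two Weil-covariant operators over `π(r)`).
[cite: Folland1989, Prop. (1.50), §4.2 p. 156; Weil1964, Chap. III n° 38 p. 189] -/
theorem exists_eq_smul_carrierConjEquiv : ∃ c : ℂ, c ≠ 0 ∧ ∀ Φ, A Φ = c • carrierConjEquiv e z.1.2 Φ :=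
  exists_smul_of_archCovariant T e hT' (adelicMpCont.proj F ι T r) A (carrierConjEquiv e z.1.2)
    (archCovariant_of_map_tmul' r A P (coe_snd_apply_tmul T r A P hr)) (carrierConjEquiv_archModTrans_of_proj T e hT' _ z hz)

set_option maxHeartbeats 800000 in
-- (instance unification on `𝓢((ι → F ⊗ ℝ), ℂ)` and the coerced symplectic phase maps is expensive)
include hr in
/-- the tensor form of `ω(r⁻¹)`: `ω(r⁻¹)(Φ_∞ ⊗ f) = A⁻¹ Φ_∞ ⊗ P⁻¹ f`. [cite: Weil1964, Chap. III n° 38 p. 190] -/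
theorem omega_inv_tmul (Φ : 𝓢((ι → mixedSpace F), ℂ)) (f : FinSB F ι) :
    adelicMpCont.omega F ι T r⁻¹ (piSchwartzBruhatEquiv F ι (Φ ⊗ₜ f)) =
      piSchwartzBruhatEquiv F ι (A.symm Φ ⊗ₜ P.symm f) := by
  have h := hr (A.symm Φ) (P.symm f)
  simp only [ContinuousLinearEquiv.apply_symm_apply, LinearEquiv.apply_symm_apply] at h
  have h2 : ∀ Ψ, adelicMpCont.omega F ι T r⁻¹ (adelicMpCont.omega F ι T r Ψ) = Ψ := fun Ψ => by
    have h3 : adelicMpCont.omega F ι T (r⁻¹ * r) = 1 := by rw [inv_mul_cancel, map_one]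
    rw [map_mul] at h3
    exact LinearMap.congr_fun h3 Ψ
  rw [← h]
  exact h2 _

set_option maxHeartbeats 800000 in
-- (instance unification on `𝓢((ι → F ⊗ ℝ), ℂ)` and the coerced symplectic phase maps is expensive)
include hr in
/-- `ω(r · X · r⁻¹)(Φ_∞ ⊗ f) = (A B A⁻¹ Φ_∞) ⊗ f` for `ω(X) = B ⊗ 1`. [cite: Weil1964, Chap. III n° 38 p. 190] -/
theorem omega_conj_tmul_of_arch (X : adelicMpCont F ι T) (B : 𝓢((ι → mixedSpace F), ℂ) ≃L[ℂ] 𝓢((ι → mixedSpace F), ℂ))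
    (hX : ∀ (Φ : 𝓢((ι → mixedSpace F), ℂ)) (f : FinSB F ι),
      adelicMpCont.omega F ι T X (piSchwartzBruhatEquiv F ι (Φ ⊗ₜ f)) = piSchwartzBruhatEquiv F ι (B Φ ⊗ₜ f))
    (Φ : 𝓢((ι → mixedSpace F), ℂ)) (f : FinSB F ι) :
    adelicMpCont.omega F ι T (r * X * r⁻¹) (piSchwartzBruhatEquiv F ι (Φ ⊗ₜ f)) =
      piSchwartzBruhatEquiv F ι (A (B (A.symm Φ)) ⊗ₜ f) := by
  simp only [map_mul, Module.End.mul_apply, omega_inv_tmul T r A P hr, hX, hr, LinearEquiv.apply_symm_apply]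

end Covariant

omit [DecidableEq ι] [DecidableEq σ] in
/-- the origin value of `e^* w e_*` is that of `w`: `(e^* w e_* Φ)(0) = (w (e_* Φ))(0)`, `(e_* Φ)(0) = Φ(0)`.
[cite: Folland1989, §1.3 (1.25)] -/
theorem carrierConjEquiv_apply_zero (w : MpS σ) {κ : ℂ} (hw : ∀ f : (SchwartzMap (σ → ℝ) ℂ), w.1.2 f 0 = κ * f 0)
    (Φ : 𝓢((ι → mixedSpace F), ℂ)) : carrierConjEquiv e w.1.2 Φ 0 = κ * Φ 0 := by
  rw [carrierConjEquiv_apply, schwartzTransport_symm_apply, map_zero, hw, schwartzTransport_apply, map_zero]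

/-! ## §2 Conjugating the lift by `r` is conjugating the section by `z` -/

section Conj

variable {G : Type*} [Group G] (j : G →* symplecticGroup (polar (adelicForm F ι T))) (s : G →* MpS σ)
  (hj : ∀ (g : G) (k c : ι → FiniteAdeleRing (𝓞 F) F), (j g).1 (finVec k, finVec c) = (finVec k, finVec c))
  (hdict : ∀ g : G, archPhaseMap T e hT' (j g) =
    ⇑((MpS.proj (s g)).1 : ((σ → ℝ) × (σ → ℝ)) ≃ₗ[ℝ] ((σ → ℝ) × (σ → ℝ))))
  (r : adelicMpCont F ι T)
  (A : 𝓢((ι → mixedSpace F), ℂ) ≃L[ℂ] 𝓢((ι → mixedSpace F), ℂ)) (P : FinSB F ι ≃ₗ[ℂ] FinSB F ι)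
  (hr : ∀ (Φ : 𝓢((ι → mixedSpace F), ℂ)) (f : FinSB F ι),
    adelicMpCont.omega F ι T r (piSchwartzBruhatEquiv F ι (Φ ⊗ₜ f)) = piSchwartzBruhatEquiv F ι (A Φ ⊗ₜ P f))
  (z : MpS σ)
  (hz : (⇑((MpS.proj z).1 : ((σ → ℝ) × (σ → ℝ)) ≃ₗ[ℝ] ((σ → ℝ) × (σ → ℝ))) :
      ((σ → ℝ) × (σ → ℝ)) → ((σ → ℝ) × (σ → ℝ))) = archPhaseMap T e hT' (adelicMpCont.proj F ι T r))

set_option maxHeartbeats 800000 in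
-- (instance unification on `𝓢((ι → F ⊗ ℝ), ℂ)` and the coerced symplectic phase maps is expensive)
include hr hz in
/-- **`ω(r · archLift g · r⁻¹)(Φ_∞ ⊗ f) = (e^* (z s(g) z⁻¹) e_* Φ_∞) ⊗ f`.** [cite: Weil1964, Chap. III n° 38 pp. 189–190;
Folland1989, §4.2 (4.23)] -/
theorem omega_conj_archLift_tmul (g : G) (Φ : 𝓢((ι → mixedSpace F), ℂ)) (f : FinSB F ι) :
    adelicMpCont.omega F ι T (r * archLift T e hT' j s hj hdict g * r⁻¹) (piSchwartzBruhatEquiv F ι (Φ ⊗ₜ f)) =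
      piSchwartzBruhatEquiv F ι (carrierConjEquiv e (z * s g * z⁻¹).1.2 Φ ⊗ₜ f) := by
  obtain ⟨c, hc, hA⟩ := exists_eq_smul_carrierConjEquiv T e hT' r A P hr z hz
  have hAinv : A.symm Φ = c⁻¹ • (carrierConjEquiv e z.1.2).symm Φ := by
    have h := hA ((carrierConjEquiv e z.1.2).symm Φ)
    simp only [ContinuousLinearEquiv.apply_symm_apply] at h
    have h' : (carrierConjEquiv e z.1.2).symm Φ = c • A.symm Φ := by
      apply A.injective
      simp only [map_smul, ContinuousLinearEquiv.apply_symm_apply, h]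
    rw [h', smul_smul, inv_mul_cancel₀ hc, one_smul]
  have hZ : carrierConjEquiv e (z * s g * z⁻¹).1.2 Φ =
      carrierConjEquiv e z.1.2 (carrierConjEquiv e (s g).1.2 ((carrierConjEquiv e z.1.2).symm Φ)) := by
    have h3 : (carrierConjEquiv e z.1.2).symm Φ = carrierConjEquiv e z⁻¹.1.2 Φ := by
      apply (carrierConjEquiv e z.1.2).injective
      simp only [ContinuousLinearEquiv.apply_symm_apply]
      show Φ = (carrierConjEquiv e z.1.2 * carrierConjEquiv e z⁻¹.1.2) Φ
      rw [← carrierConjEquiv_mul, ← MpS.coe_snd_mul, mul_inv_cancel, MpS.coe_snd_one, carrierConjEquiv_one]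
      rfl
    rw [h3]
    simp only [MpS.coe_snd_mul, carrierConjEquiv_mul]
    rfl
  simp only [omega_conj_tmul_of_arch T r A P hr (archLift T e hT' j s hj hdict g) (carrierConjEquiv e (s g).1.2)
    (omega_archLift_tmul T e hT' j s hj hdict g), hAinv, map_smul, hA, smul_smul, mul_inv_cancel₀ hc, one_smul, hZ]

/-! ## §3 The value at the origin, for every `Ψ ∈ 𝒮(𝔸^ι)` -/

set_option maxHeartbeats 800000 in
-- (instance unification on `𝓢((ι → F ⊗ ℝ), ℂ)` and the coerced symplectic phase maps is expensive)
include hr hz in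
/-- **the origin value of `ω(r · archLift g · r⁻¹)` on ALL of `𝒮(𝔸^ι)`**: if `(w f)(0) = κ f(0)` on `𝓢(ℝ^σ)` for
`w = z s(g) z⁻¹`, then `(ω(r · archLift g · r⁻¹) Ψ)(0) = κ Ψ(0)`. [cite: Weil1964, Chap. I n° 13, Chap. III n° 38 p. 190] -/
theorem omega_conj_archLift_apply_zero (g : G) {κ : ℂ} (hw : ∀ f : (SchwartzMap (σ → ℝ) ℂ), (z * s g * z⁻¹).1.2 f 0 = κ * f 0)
    (Ψ : piSchwartzBruhat F ι) :
    ((adelicMpCont.omega F ι T (r * archLift T e hT' j s hj hdict g * r⁻¹) Ψ : piSchwartzBruhat F ι) :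
        (ι → AdeleRing (𝓞 F) F) → ℂ) 0 =
      κ * (Ψ : (ι → AdeleRing (𝓞 F) F) → ℂ) 0 := by
  obtain ⟨t, rfl⟩ := (piSchwartzBruhatEquiv F ι).surjective Ψ
  have h0a : piArch F ι (0 : ι → AdeleRing (𝓞 F) F) = 0 := funext fun i => by rw [piArch_apply]; exact map_zero _
  have h0f : piFinite F ι (0 : ι → AdeleRing (𝓞 F) F) = 0 := rfl
  induction t using TensorProduct.induction_on with
  | zero => simp only [map_zero, ZeroMemClass.coe_zero, Pi.zero_apply, mul_zero]
  | tmul Φ f =>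
    rw [omega_conj_archLift_tmul T e hT' j s hj hdict r A P hr z hz g Φ f]
    simp only [coe_piSchwartzBruhatEquiv_tmul, h0a, h0f]
    rw [carrierConjEquiv_apply_zero e _ hw, mul_assoc]
  | add t₁ t₂ h₁ h₂ => simp only [map_add, Submodule.coe_add, Pi.add_apply, h₁, h₂, mul_add]

end Conj

/-! ## §4 The Siegel decomposition of `z s(g) z⁻¹` and the value at the origin -/

section Siegel

variable {G : Type*} [Group G] (j : G →* symplecticGroup (polar (adelicForm F ι T))) (s : G →* MpS σ)
  (hdict : ∀ g : G, archPhaseMap T e hT' (j g) =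
    ⇑((MpS.proj (s g)).1 : ((σ → ℝ) × (σ → ℝ)) ≃ₗ[ℝ] ((σ → ℝ) × (σ → ℝ))))
  (r : adelicMpCont F ι T) (z : MpS σ)
  (hz : (⇑((MpS.proj z).1 : ((σ → ℝ) × (σ → ℝ)) ≃ₗ[ℝ] ((σ → ℝ) × (σ → ℝ))) :
      ((σ → ℝ) × (σ → ℝ)) → ((σ → ℝ) × (σ → ℝ))) = archPhaseMap T e hT' (adelicMpCont.proj F ι T r))



omit [DecidableEq σ] in
/-- `π(x y) v = π(x) (π(y) v)`. [cite: Folland1989, §4.2 (4.23)] -/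
theorem MpS.proj_mul_apply (x y : MpS σ) (v : (σ → ℝ) × (σ → ℝ)) :
    ((MpS.proj (x * y)).1 : ((σ → ℝ) × (σ → ℝ)) ≃ₗ[ℝ] ((σ → ℝ) × (σ → ℝ))) v =
      ((MpS.proj x).1 : ((σ → ℝ) × (σ → ℝ)) ≃ₗ[ℝ] ((σ → ℝ) × (σ → ℝ)))
        (((MpS.proj y).1 : ((σ → ℝ) × (σ → ℝ)) ≃ₗ[ℝ] ((σ → ℝ) × (σ → ℝ))) v) := rfl

omit [DecidableEq σ] in
/-- `π(x⁻¹) v = π(x)⁻¹ v`. [cite: Folland1989, §4.2 (4.23)] -/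
theorem MpS.proj_inv_apply (x : MpS σ) (v : (σ → ℝ) × (σ → ℝ)) :
    ((MpS.proj x⁻¹).1 : ((σ → ℝ) × (σ → ℝ)) ≃ₗ[ℝ] ((σ → ℝ) × (σ → ℝ))) v =
      ((MpS.proj x).1 : ((σ → ℝ) × (σ → ℝ)) ≃ₗ[ℝ] ((σ → ℝ) × (σ → ℝ))).symm v := rfl

include hz in
omit [DecidableEq σ] in
/-- `π(z)⁻¹` is the archimedean phase map of `π(r)⁻¹`. [cite: Folland1989, §4.1 Prop. (4.10)] -/
theorem proj_symm_apply_eq (v : (σ → ℝ) × (σ → ℝ)) :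
    ((MpS.proj z).1 : ((σ → ℝ) × (σ → ℝ)) ≃ₗ[ℝ] ((σ → ℝ) × (σ → ℝ))).symm v =
      archPhaseMap T e hT' (adelicMpCont.proj F ι T r)⁻¹ v := by
  apply ((MpS.proj z).1 : ((σ → ℝ) × (σ → ℝ)) ≃ₗ[ℝ] ((σ → ℝ) × (σ → ℝ))).injective
  have h := congrFun hz (archPhaseMap T e hT' (adelicMpCont.proj F ι T r)⁻¹ v)
  have h' : archPhaseMap T e hT' (adelicMpCont.proj F ι T r) (archPhaseMap T e hT' (adelicMpCont.proj F ι T r)⁻¹ v) = v := by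
    rw [← archPhaseMap_mul, mul_inv_cancel, archPhaseMap_one]
  simp only [LinearEquiv.apply_symm_apply]
  exact (h.trans h').symm

include hdict hz in
omit [DecidableEq σ] in
/-- the phase map of `w = z s(g) z⁻¹` is the archimedean phase map of `π(r) j(g) π(r)⁻¹`.
[cite: Folland1989, §4.1 Prop. (4.10)] -/
theorem coe_proj_conj (g : G) :
    (⇑((MpS.proj (z * s g * z⁻¹)).1 : ((σ → ℝ) × (σ → ℝ)) ≃ₗ[ℝ] ((σ → ℝ) × (σ → ℝ))) :
        ((σ → ℝ) × (σ → ℝ)) → ((σ → ℝ) × (σ → ℝ))) =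
      archPhaseMap T e hT' (adelicMpCont.proj F ι T r * j g * (adelicMpCont.proj F ι T r)⁻¹) := by
  funext v
  simp only [MpS.proj_mul_apply, MpS.proj_inv_apply, archPhaseMap_mul, proj_symm_apply_eq T e hT' r z hz]
  have h2 : ((MpS.proj (s g)).1 : ((σ → ℝ) × (σ → ℝ)) ≃ₗ[ℝ] ((σ → ℝ) × (σ → ℝ)))
        (archPhaseMap T e hT' (adelicMpCont.proj F ι T r)⁻¹ v) =
      archPhaseMap T e hT' (j g) (archPhaseMap T e hT' (adelicMpCont.proj F ι T r)⁻¹ v) :=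
    (congrFun (hdict g) _).symm
  exact (congrFun hz _).trans (congrArg (archPhaseMap T e hT' (adelicMpCont.proj F ι T r)) h2)

omit [DecidableEq σ] in
/-- the archimedean phase map of an element of `P_Y(𝔸)` preserves `0 × ℝ^σ`. [cite: Weil1964, Chap. III n° 46 p. 202] -/
theorem archPhaseMap_apply_zero_fst (q : symplecticGroup (polar (adelicForm F ι T)))
    (hq : ∀ y : ι → AdeleRing (𝓞 F) F, (q.1 (0, y)).1 = 0) (y : σ → ℝ) : (archPhaseMap T e hT' q (0, y)).1 = 0 := by
  obtain ⟨⟨a, w⟩, haw⟩ := (archFolland_bijective T e hT').2 ((0 : σ → ℝ), y)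
  have ha : a = 0 := by
    have h := congrArg Prod.fst haw
    rw [archFolland_fst] at h
    exact e.injective (h.trans (map_zero e).symm)
  subst ha
  rw [← haw, archPhaseMap_archFolland, archFolland_fst]
  have h1 : (archAct T q (0, w)).1 = 0 := by
    simp only [archAct]
    have h0 : archVec F ι (0 : ι → mixedSpace F) = 0 := by
      have h := archVec_add (F := F) (ι := ι) 0 0
      rw [add_zero] at h
      exact left_eq_add.1 h
    rw [h0, hq]
    funext i; rw [piArch_apply]; exact map_zero _
  rw [h1, map_zero]

include hdict hz in
omit [DecidableEq σ] in
/-- if `q := π(r) j(g) π(r)⁻¹` preserves `𝕐 = 0 × 𝔸^ι` then `π(z s(g) z⁻¹)` preserves `0 × ℝ^σ`.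
[cite: Weil1964, Chap. III n° 46 p. 202] -/
theorem proj_conj_apply_zero_fst (g : G)
    (hq : ∀ y : ι → AdeleRing (𝓞 F) F, ((adelicMpCont.proj F ι T r * j g * (adelicMpCont.proj F ι T r)⁻¹).1 (0, y)).1 = 0)
    (y : σ → ℝ) :
    (((MpS.proj (z * s g * z⁻¹)).1 : ((σ → ℝ) × (σ → ℝ)) ≃ₗ[ℝ] ((σ → ℝ) × (σ → ℝ))) (0, y)).1 = 0 :=
  (congrArg Prod.fst (congrFun (coe_proj_conj T e hT' j s hdict r z hz g) (0, y))).trans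
    (archPhaseMap_apply_zero_fst T e hT' _ hq y)

set_option maxHeartbeats 800000 in
-- (instance unification on `𝓢((ι → F ⊗ ℝ), ℂ)` and the coerced symplectic phase maps is expensive)
include hdict hz in
omit [DecidableEq σ] in
/-- if `q⁻¹` preserves `𝕐` then `π(z s(g) z⁻¹)⁻¹` preserves `0 × ℝ^σ`. [cite: Weil1964, Chap. III n° 46 p. 202] -/
theorem proj_conj_symm_apply_zero_fst (g : G)
    (hq' : ∀ y : ι → AdeleRing (𝓞 F) F,
      ((adelicMpCont.proj F ι T r * j g * (adelicMpCont.proj F ι T r)⁻¹)⁻¹.1 (0, y)).1 = 0)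
    (y : σ → ℝ) :
    (((MpS.proj (z * s g * z⁻¹)).1 : ((σ → ℝ) × (σ → ℝ)) ≃ₗ[ℝ] ((σ → ℝ) × (σ → ℝ))).symm (0, y)).1 = 0 := by
  have e2 : (z * s g * z⁻¹)⁻¹ = z * s g⁻¹ * z⁻¹ := by rw [map_inv]; group
  have e4 : adelicMpCont.proj F ι T r * j g⁻¹ * (adelicMpCont.proj F ι T r)⁻¹ =
      (adelicMpCont.proj F ι T r * j g * (adelicMpCont.proj F ι T r)⁻¹)⁻¹ := by rw [map_inv]; group
  have e3 := congrArg Prod.fst (congrFun (coe_proj_conj T e hT' j s hdict r z hz g⁻¹) (0, y))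
  rw [e4] at e3
  rw [← MpS.proj_inv_apply, e2]
  exact e3.trans (archPhaseMap_apply_zero_fst T e hT' _ hq' y)

set_option maxHeartbeats 800000 in
-- (instance unification on `𝓢((ι → F ⊗ ℝ), ℂ)` and the coerced symplectic phase maps is expensive)
include hdict hz in
/-- **THE SIEGEL DECOMPOSITION OF `w = z s(g) z⁻¹`.**  If `q := π(r) j(g) π(r)⁻¹` and its inverse preserve the Lagrangian
`𝕐 = 0 × 𝔸^ι`, then `π(w) = m(a, d) n(b)` with `a x = (archPhaseMap q (x, 0)).1`, `w = u · (levi a d · unip b)` for a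
unimodular `u`, and `(w f)(0) = u · |det a|^{-1/2} · f(0)` on `𝓢(ℝ^σ)` — so that (`omega_conj_archLift_apply_zero`)
`(ω(r · archLift g · r⁻¹) Ψ)(0) = u · |det a|^{-1/2} · Ψ(0)` for every `Ψ ∈ 𝒮(𝔸^ι)`.
[cite: Kudla1994, §3 (3.5); HarrisKudlaSweet1996, §1; Folland1989, §4.2 (4.24)–(4.25); Weil1964, Chap. III n° 46 (42)] -/
theorem exists_siegel_of_conj (g : G)
    (hq : ∀ y : ι → AdeleRing (𝓞 F) F, ((adelicMpCont.proj F ι T r * j g * (adelicMpCont.proj F ι T r)⁻¹).1 (0, y)).1 = 0)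
    (hq' : ∀ y : ι → AdeleRing (𝓞 F) F,
      ((adelicMpCont.proj F ι T r * j g * (adelicMpCont.proj F ι T r)⁻¹)⁻¹.1 (0, y)).1 = 0) :
    ∃ (a d : (σ → ℝ) ≃ₗ[ℝ] (σ → ℝ)) (had : ∀ x y, dotPairing σ (a x) (d y) = dotPairing σ x y)
      (b : (σ → ℝ) →ₗ[ℝ] (σ → ℝ)) (hb : ∀ x x', dotPairing σ x (b x') = dotPairing σ x' (b x)) (u : ℂ) (hu : ‖u‖ = 1),
      MpS.proj (z * s g * z⁻¹) = leviSp (dotPairing σ) a d had * unipotentSp (dotPairing σ) b hb ∧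
      (∀ x, a x = (archPhaseMap T e hT' (adelicMpCont.proj F ι T r * j g * (adelicMpCont.proj F ι T r)⁻¹) (x, 0)).1) ∧
      z * s g * z⁻¹ = unitScalar u hu * (levi a d had * unip b hb) ∧
      ∀ f : (SchwartzMap (σ → ℝ) ℂ), (z * s g * z⁻¹).1.2 f 0 = u * leviFactor a * f 0 := by
  obtain ⟨a, d, had, b, hb, hdec, hax⟩ :=
    exists_eq_leviSp_mul_unipotentSp_of_preserves (MpS.proj (z * s g * z⁻¹))
      (proj_conj_apply_zero_fst T e hT' j s hdict r z hz g hq) (proj_conj_symm_apply_zero_fst T e hT' j s hdict r z hz g hq')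
  obtain ⟨u, hu, hwu, hval⟩ := MpS.apply_zero_of_proj_eq_levi_mul_unip (z * s g * z⁻¹) a d had b hb hdec
  exact ⟨a, d, had, b, hb, u, hu, hdec,
    fun x => (hax x).trans (congrArg Prod.fst (congrFun (coe_proj_conj T e hT' j s hdict r z hz g) (x, 0))), hwu, hval⟩

include hdict hz in
omit [DecidableEq σ] in
/-- **the `𝕐`-block of the Siegel decomposition**: with `π(z s(g) z⁻¹) = m(a, d) n(b)`, `d y = (archPhaseMap q (0, y)).2`
(`q = π(r) j(g) π(r)⁻¹`). [cite: Weil1964, Chap. III n° 46, (42) p. 202; Folland1989, §4.2 (4.24)] -/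
theorem levi_snd_eq_archPhaseMap (g : G) {a d : (σ → ℝ) ≃ₗ[ℝ] (σ → ℝ)}
    {had : ∀ x y, dotPairing σ (a x) (d y) = dotPairing σ x y} {b : (σ → ℝ) →ₗ[ℝ] (σ → ℝ)}
    {hb : ∀ x x', dotPairing σ x (b x') = dotPairing σ x' (b x)}
    (hdec : MpS.proj (z * s g * z⁻¹) = leviSp (dotPairing σ) a d had * unipotentSp (dotPairing σ) b hb) (y : σ → ℝ) :
    d y = (archPhaseMap T e hT' (adelicMpCont.proj F ι T r * j g * (adelicMpCont.proj F ι T r)⁻¹) (0, y)).2 := by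
  have h1 := congrArg Prod.snd (congrFun (coe_proj_conj T e hT' j s hdict r z hz g) (0, y))
  have h2 : ∀ w : symplecticGroup (polar (dotPairing σ)), w = MpS.proj (z * s g * z⁻¹) →
      ((w.1 : ((σ → ℝ) × (σ → ℝ)) ≃ₗ[ℝ] ((σ → ℝ) × (σ → ℝ))) (0, y)).2 =
        (archPhaseMap T e hT' (adelicMpCont.proj F ι T r * j g * (adelicMpCont.proj F ι T r)⁻¹) (0, y)).2 := by
    rintro w rfl; exact h1
  exact (congrArg Prod.snd (leviSp_mul_unipotentSp_apply_zero a d had b hb y)).symm.trans (h2 _ hdec.symm)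

/-- **the square of the unimodular part is the quotient character of the section**: with the data of
`exists_originValue_of_siegel` and `det a > 0`, `u² = quot (s g)`. [cite: Folland1989, §4.2 Thm. (4.37); Kudla1994, §3] -/
theorem sq_originValue_eq_quot (g : G) {a d : (σ → ℝ) ≃ₗ[ℝ] (σ → ℝ)}
    {had : ∀ x y, dotPairing σ (a x) (d y) = dotPairing σ x y} (hdet : 0 < LinearMap.det (a : (σ → ℝ) →ₗ[ℝ] (σ → ℝ)))
    {b : (σ → ℝ) →ₗ[ℝ] (σ → ℝ)} {hb : ∀ x x', dotPairing σ x (b x') = dotPairing σ x' (b x)} {u : ℂ} {hu : ‖u‖ = 1}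
    (hw : z * s g * z⁻¹ = unitScalar u hu * (levi a d had * unip b hb)) : u ^ 2 = quot (s g) := by
  rw [MpS.sq_originScalar_eq_quot hdet hw, MpS.quot_conj]

end Siegel

end Literature.NumberTheory.Weil1964

end

/-! ### Build-lane note (ops-buildfix G11b-3 recipe v2, LEDGER B13-1/B14-5/B14-7, 2026-08-22)
`lean -o` (the hub build lane, never `lean`/the gate check) runs Lean 4.32's library-suggestion indexers
(`Lean.LibrarySuggestions.SymbolFrequency` / `SineQuaNon`, from their `exportEntriesFn`) over the statement of every local
theorem constant that is not a denied premise; on this family's statements (very large dependent binder telescopes) that fold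
runs for tens of minutes (incident G11b-3, run/shared/lean/ops/buildfix/G11b-3-DOSSIER.md). `isDeniedPremise` skips
`[implicit_reducible]` constants before any fold, and the status is inert on theorems (Meta never unfolds `thmInfo`).
v2 form: ONE file-final, top-level `local` attribute — it goes through the synchronous scoped reducibility extension that
`getReducibilityStatusCore` reads first, so it needs no `set_option Elab.async false` (parallel elaboration stays on), also
reaches auto-realized `*.congr_simp` / structure-projection theorem constants, is never popped before export, and is not
exported. No statement or proof is changed. -/
set_option allowUnsafeReducibility true in
attribute [local implicit_reducible]
  Literature.NumberTheory.Weil1964.exists_omega_tmul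
  Literature.NumberTheory.Weil1964.carrierConjEquiv_archModTrans_of_proj
  Literature.NumberTheory.Weil1964.coe_snd_apply_tmul
  Literature.NumberTheory.Weil1964.exists_eq_smul_carrierConjEquiv
  Literature.NumberTheory.Weil1964.omega_inv_tmul
  Literature.NumberTheory.Weil1964.omega_conj_tmul_of_arch
  Literature.NumberTheory.Weil1964.carrierConjEquiv_apply_zero
  Literature.NumberTheory.Weil1964.omega_conj_archLift_tmul
  Literature.NumberTheory.Weil1964.omega_conj_archLift_apply_zero
  Literature.NumberTheory.Weil1964.MpS.proj_mul_apply
  Literature.NumberTheory.Weil1964.MpS.proj_inv_apply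
  Literature.NumberTheory.Weil1964.proj_symm_apply_eq
  Literature.NumberTheory.Weil1964.coe_proj_conj
  Literature.NumberTheory.Weil1964.archPhaseMap_apply_zero_fst
  Literature.NumberTheory.Weil1964.proj_conj_apply_zero_fst
  Literature.NumberTheory.Weil1964.proj_conj_symm_apply_zero_fst
  Literature.NumberTheory.Weil1964.exists_siegel_of_conj
  Literature.NumberTheory.Weil1964.levi_snd_eq_archPhaseMap
  Literature.NumberTheory.Weil1964.sq_originValue_eq_quot
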